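import Literature.ModelTheory.ExponentialFields.DefinablyCompleteIntervals
import Mathlib.Topology.Algebra.Order.Field
import Mathlib.LinearAlgebra.AffineSpace.Slope
import Mathlib.Analysis.Calculus.Deriv.Slope
import HarnessLib

/-!
# Definable one-variable calculus in definably complete ordered fields

Topic `Literature/ModelTheory/ExponentialFields`.  Rolle's theorem and the mean value theorem
for *definable* differentiable functions on an ordered field carrying a definably complete
structure (`FirstOrder.Language.IsDefinablyComplete`), the setting of the models of the
recursive subtheory `OEF ∪ [DC]` of `Th(ℝ_exp)` (`DefinableCompletenessCodes.lean`,
`exists_recursive_subtheory_definablyComplete`) in which the Fornasiero–Servi / Jones–Servi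
route to Macintyre–Wilkie's effective model completeness works ("definably complete
structures … a weak version of Dedekind completeness"; the one-variable calculus of definable
functions holds in them: C. Miller, *Expansions of dense linear orders with the intermediate
value property*, J. Symbolic Logic 66 (2001); Fornasiero–Servi 2010, §1.2).  In a general
ordered field there is no norm, so the derivative is the limit of the difference quotients in
the order topology:

* `HasFieldDerivAt f f' x` — `slope f x → f'` along `𝓝[≠] x` (a definition; for `ℝ`, or any
  nontrivially normed field, it is Mathlib's `HasDerivAt`: `hasFieldDerivAt_iff_hasDerivAt`);
* `HasFieldDerivAt.eq_zero_of_isMaxOn` — Fermat's lemma at an interior extremum;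
* **`IsDefinablyComplete.exists_hasFieldDerivAt_eq_zero`** — Rolle's theorem for functions with
  definable graph (the extreme value theorem of `DefinablyCompleteIntervals.lean` supplies the
  interior extremum);
* **`IsDefinablyComplete.exists_hasFieldDerivAt_eq_slope`** — the mean value theorem, and its
  consequences `eq_of_hasFieldDerivAt_eq_zero` (zero derivative on `(a, b)` forces
  `f b = f a`) and `lt_of_hasFieldDerivAt_pos` (positive derivative forces `f a < f b`).

Definability conventions as in `OMinimalExtremeValue.lean` / `DefinablyCompleteIntervals.lean`
(`hlt`: `<` definable; `hf`: the graph of `f` definable); the mean value theorem also needs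
the graphs of `+` and `*` to be definable (`hadd`, `hmul`), as they are in any expansion of the
ordered field.  Everything is proved; the only definition is `HasFieldDerivAt`.

## References

* C. Miller, *Expansions of dense linear orders with the intermediate value property*,
  J. Symbolic Logic 66 (2001) 1783–1790. [Miller2001]
* A. Fornasiero, T. Servi, *Definably complete Baire structures*, Fund. Math. 209 (2010),
  §1.2. [FornasieroServi2010]
-/

open Set FirstOrder FirstOrder.Language
open _root_.Filter _root_.Topology

namespace Literature.ModelTheory.ExponentialFields

universe u v

/-! ### The derivative in a topological field -/

section Deriv

variable {K : Type*} [Field K] [TopologicalSpace K]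

/-- **The derivative in a topological field**: `f` has derivative `f'` at `x` if the difference
quotients `slope f x y = (f y - f x) / (y - x)` tend to `f'` as `y → x`, `y ≠ x`.  In a general
(e.g. non-archimedean) ordered field with its order topology there is no norm, so Mathlib's
`HasDerivAt` is not available; for a nontrivially normed field the two notions agree
(`hasFieldDerivAt_iff_hasDerivAt`, Mathlib's `hasDerivAt_iff_tendsto_slope`).  A definition,
not a claim. [folklore] -/
def HasFieldDerivAt (f : K → K) (f' x : K) : Prop :=
  Tendsto (slope f x) (𝓝[≠] x) (𝓝 f')

/-- Unfolding lemma. [folklore] -/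
theorem hasFieldDerivAt_iff {f : K → K} {f' x : K} :
    HasFieldDerivAt f f' x ↔ Tendsto (fun y => (f y - f x) / (y - x)) (𝓝[≠] x) (𝓝 f') := by
  simp only [HasFieldDerivAt, slope_fun_def_field]

/-- For a nontrivially normed field (e.g. `ℝ`) the field derivative is Mathlib's derivative.
[folklore] -/
theorem hasFieldDerivAt_iff_hasDerivAt {𝕜 : Type*} [NontriviallyNormedField 𝕜] {f : 𝕜 → 𝕜}
    {f' x : 𝕜} : HasFieldDerivAt f f' x ↔ HasDerivAt f f' x :=
  hasDerivAt_iff_tendsto_slope.symm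

/-- The derivative is unique where the punctured neighbourhood filter is non-trivial. [folklore] -/
theorem HasFieldDerivAt.unique [T2Space K] {f : K → K} {f' g' x : K} [NeBot (𝓝[≠] x)]
    (hf : HasFieldDerivAt f f' x) (hg : HasFieldDerivAt f g' x) : f' = g' :=
  tendsto_nhds_unique hf hg

/-- Subtracting an affine function shifts the derivative by its slope. [folklore] -/
theorem HasFieldDerivAt.sub_linear [IsTopologicalRing K] {f : K → K} {f' x : K}
    (hf : HasFieldDerivAt f f' x) (m c : K) :
    HasFieldDerivAt (fun y => f y - (m * y + c)) (f' - m) x := by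
  rw [hasFieldDerivAt_iff] at hf ⊢
  have h : Tendsto (fun y => (f y - f x) / (y - x) - m) (𝓝[≠] x) (𝓝 (f' - m)) :=
    hf.sub tendsto_const_nhds
  refine h.congr' (eventually_nhdsWithin_of_forall fun y hy => ?_)
  have hyx : y - x ≠ 0 := sub_ne_zero.2 hy
  field_simp
  ring

end Deriv

/-! ### Fermat's lemma and Rolle's theorem in an ordered field -/

section Ordered

variable {K : Type*} [Field K] [LinearOrder K] [IsStrictOrderedRing K] [TopologicalSpace K]
  [OrderTopology K]

/-- **Fermat**: at an interior maximum point of `f` on `(a, b)` the derivative vanishes (the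
difference quotients are `≤ 0` on the right and `≥ 0` on the left). [folklore] -/
theorem HasFieldDerivAt.eq_zero_of_isMaxOn {f : K → K} {f' a b c : K} (hc : c ∈ Ioo a b)
    (hmax : IsMaxOn f (Ioo a b) c) (hder : HasFieldDerivAt f f' c) : f' = 0 := by
  rw [hasFieldDerivAt_iff] at hder
  have hright : f' ≤ 0 := by
    have ht : Tendsto (fun y => (f y - f c) / (y - c)) (𝓝[>] c) (𝓝 f') :=
      hder.mono_left (nhdsWithin_mono _ fun y hy => ne_of_gt hy)
    refine le_of_tendsto ht ?_
    filter_upwards [Ioo_mem_nhdsGT hc.2] with y hy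
    exact div_nonpos_of_nonpos_of_nonneg (sub_nonpos.2 (hmax ⟨hc.1.trans hy.1, hy.2⟩))
      (sub_nonneg.2 hy.1.le)
  have hleft : 0 ≤ f' := by
    have ht : Tendsto (fun y => (f y - f c) / (y - c)) (𝓝[<] c) (𝓝 f') :=
      hder.mono_left (nhdsWithin_mono _ fun y hy => ne_of_lt hy)
    refine ge_of_tendsto ht ?_
    filter_upwards [Ioo_mem_nhdsLT hc.1] with y hy
    exact div_nonneg_of_nonpos (sub_nonpos.2 (hmax ⟨hy.1, hy.2.trans hc.2⟩))
      (sub_nonpos.2 hy.2.le)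
  exact le_antisymm hright hleft

/-- **Fermat** at an interior minimum point. [folklore] -/
theorem HasFieldDerivAt.eq_zero_of_isMinOn {f : K → K} {f' a b c : K} (hc : c ∈ Ioo a b)
    (hmin : IsMinOn f (Ioo a b) c) (hder : HasFieldDerivAt f f' c) : f' = 0 := by
  rw [hasFieldDerivAt_iff] at hder
  have hright : 0 ≤ f' := by
    have ht : Tendsto (fun y => (f y - f c) / (y - c)) (𝓝[>] c) (𝓝 f') :=
      hder.mono_left (nhdsWithin_mono _ fun y hy => ne_of_gt hy)
    refine ge_of_tendsto ht ?_
    filter_upwards [Ioo_mem_nhdsGT hc.2] with y hy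
    exact div_nonneg (sub_nonneg.2 (hmin ⟨hc.1.trans hy.1, hy.2⟩)) (sub_nonneg.2 hy.1.le)
  have hleft : f' ≤ 0 := by
    have ht : Tendsto (fun y => (f y - f c) / (y - c)) (𝓝[<] c) (𝓝 f') :=
      hder.mono_left (nhdsWithin_mono _ fun y hy => ne_of_lt hy)
    refine le_of_tendsto ht ?_
    filter_upwards [Ioo_mem_nhdsLT hc.1] with y hy
    exact div_nonpos_of_nonneg_of_nonpos (sub_nonneg.2 (hmin ⟨hy.1, hy.2.trans hc.2⟩))
      (sub_nonpos.2 hy.2.le)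
  exact le_antisymm hleft hright

variable {L : Language.{u, v}} [L.Structure K] {f : K → K}

omit [TopologicalSpace K] [OrderTopology K] in
/-- The graph of `-f` is definable when those of `f` and `+` are. [folklore] -/
theorem definable_graph_neg
    (hadd : (univ : Set K).Definable L {v : Fin 3 → K | v 2 = v 0 + v 1})
    (hf : (univ : Set K).Definable L {v : Fin 2 → K | v 1 = f (v 0)}) :
    (univ : Set K).Definable L {v : Fin 2 → K | v 1 = -f (v 0)} := by
  -- `v 1 = -f (v 0)` iff `0 = v 1 + f (v 0)`
  have hF : (univ : Set K).DefinableMap L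
      (fun v : Fin 2 → K => (![v 1, f (v 0), 0] : Fin 3 → K)) := by
    intro i
    fin_cases i
    · simpa using (definableFun_proj_params (L := L) (A := (univ : Set K)) (1 : Fin 2))
    · simpa using (definableFun_apply_params hf (definableFun_proj_params (0 : Fin 2)))
    · simpa using (definableFun_const_params (L := L) (Fin 2) (mem_univ (0 : K)))
  have h := hadd.preimage_map hF
  refine (congrArg _ ?_).mpr h
  ext v
  simp only [mem_setOf_eq, mem_preimage, Matrix.cons_val_zero, Matrix.cons_val_one,
    Matrix.cons_val]
  constructor
  · intro hv; rw [hv]; ring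
  · intro hv; linear_combination -hv

/-- **Rolle's theorem for definable functions** in a definably complete ordered field: a
function with definable graph, continuous on `[a, b]` (`a < b`), differentiable on `(a, b)` and
with `f a = f b` has a critical point in `(a, b)`.  (By the extreme value theorem of
`DefinablyCompleteIntervals.lean` `f` and `-f` attain their maxima on `[a, b]`; one of them is
attained inside, or `f` is constant; Fermat's lemma.)  The graph of `+` is assumed definable
(for `-f`). [folklore] -/
theorem _root_.FirstOrder.Language.IsDefinablyComplete.exists_hasFieldDerivAt_eq_zero
    (hDC : L.IsDefinablyComplete K)
    (hlt : (univ : Set K).Definable L {v : Fin 2 → K | v 0 < v 1})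
    (hadd : (univ : Set K).Definable L {v : Fin 3 → K | v 2 = v 0 + v 1})
    (hf : (univ : Set K).Definable L {v : Fin 2 → K | v 1 = f (v 0)})
    {f' : K → K} {a b : K} (hab : a < b) (hcont : ContinuousOn f (Icc a b))
    (hder : ∀ x ∈ Ioo a b, HasFieldDerivAt f (f' x) x) (hfab : f a = f b) :
    ∃ c ∈ Ioo a b, f' c = 0 := by
  obtain ⟨c, hc, hcmax⟩ := hDC.exists_forall_le_of_continuousOn_Icc hlt hf hab.le hcont
  obtain ⟨d, hd, hdmax⟩ := hDC.exists_forall_le_of_continuousOn_Icc hlt (definable_graph_neg hadd hf)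
    hab.le (hcont.neg)
  by_cases hca : f a < f c
  · -- interior maximum
    have hcI : c ∈ Ioo a b := by
      refine ⟨lt_of_le_of_ne hc.1 fun h => hca.ne (by rw [h]), lt_of_le_of_ne hc.2 fun h => ?_⟩
      rw [h, ← hfab] at hca; exact hca.false
    exact ⟨c, hcI, (hder c hcI).eq_zero_of_isMaxOn hcI fun x hx => hcmax x (Ioo_subset_Icc_self hx)⟩
  by_cases hda : f d < f a
  · -- interior minimum
    have hdI : d ∈ Ioo a b := by
      refine ⟨lt_of_le_of_ne hd.1 fun h => hda.ne (by rw [h]), lt_of_le_of_ne hd.2 fun h => ?_⟩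
      rw [h, ← hfab] at hda; exact hda.false
    refine ⟨d, hdI, (hder d hdI).eq_zero_of_isMinOn hdI fun x hx => ?_⟩
    have := hdmax x (Ioo_subset_Icc_self hx)
    simpa using this
  · -- `f` is constant on `[a, b]`
    push Not at hca hda
    have hconst : ∀ x ∈ Icc a b, f x = f a := fun x hx =>
      le_antisymm ((hcmax x hx).trans hca) (hda.trans (by simpa using hdmax x hx))
    obtain ⟨c₀, hac₀, hc₀b⟩ := exists_between hab
    have hc₀ : c₀ ∈ Ioo a b := ⟨hac₀, hc₀b⟩
    refine ⟨c₀, hc₀, ?_⟩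
    -- the difference quotients vanish near `c₀`
    have hzero : HasFieldDerivAt f 0 c₀ := by
      rw [hasFieldDerivAt_iff]
      refine (tendsto_const_nhds (x := (0 : K))).congr' ?_
      have hmem : Ioo a b ∈ 𝓝[≠] c₀ := mem_nhdsWithin_of_mem_nhds (Ioo_mem_nhds hac₀ hc₀b)
      filter_upwards [hmem] with y hy
      rw [hconst y (Ioo_subset_Icc_self hy), hconst c₀ (Ioo_subset_Icc_self hc₀), sub_self, zero_div]
    haveI : NeBot (𝓝[≠] c₀) := (nhdsGT_neBot c₀).mono (nhdsWithin_mono _ fun y hy => ne_of_gt hy)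
    exact (hder c₀ hc₀).unique hzero

/-! ### The mean value theorem -/

omit [Field K] [TopologicalSpace K] [OrderTopology K] [LinearOrder K] [IsStrictOrderedRing K] in
/-- A binary operation with definable graph, applied to two definable functions of tuples, is a
definable function of tuples (van den Dries 1998, Ch. 1, (2.3)(iii)). [folklore] -/
theorem definableFun_apply₂_params {α : Type*} {op : K → K → K}
    (hop : (univ : Set K).Definable L {v : Fin 3 → K | v 2 = op (v 0) (v 1)})
    {g h : (α → K) → K} (hg : (univ : Set K).DefinableFun L g)
    (hh : (univ : Set K).DefinableFun L h) :
    (univ : Set K).DefinableFun L (fun v => op (g v) (h v)) := by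
  have hop₂ : (univ : Set K).DefinableFun L (fun w : Fin 2 → K => op (w 0) (w 1)) := by
    have h₀ := hop.preimage_comp (![some 0, some 1, none] : Fin 3 → Option (Fin 2))
    have hEq : Function.tupleGraph (fun w : Fin 2 → K => op (w 0) (w 1)) =
        ((fun g : Option (Fin 2) → K => g ∘ (![some 0, some 1, none] : Fin 3 → Option (Fin 2))) ⁻¹'
          {v : Fin 3 → K | v 2 = op (v 0) (v 1)}) := by
      ext w
      simp only [Function.tupleGraph, mem_setOf_eq, mem_preimage, Function.comp_apply,
        Matrix.cons_val_zero, Matrix.cons_val_one, Matrix.cons_val]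
      exact eq_comm
    unfold Set.DefinableFun
    rw [hEq]
    exact h₀
  have hgh : (univ : Set K).DefinableMap L (fun v => (![g v, h v] : Fin 2 → K)) :=
    Fin.forall_fin_two.2 ⟨by simpa using hg, by simpa using hh⟩
  exact hop₂.comp hgh

omit [TopologicalSpace K] [OrderTopology K] [LinearOrder K] [IsStrictOrderedRing K] in
/-- The graph of `y ↦ f y - (m y + c)` is definable when those of `f`, `+`, `*` are. [folklore] -/
theorem definable_graph_sub_linear
    (hadd : (univ : Set K).Definable L {v : Fin 3 → K | v 2 = v 0 + v 1})
    (hmul : (univ : Set K).Definable L {v : Fin 3 → K | v 2 = v 0 * v 1})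
    (hf : (univ : Set K).Definable L {v : Fin 2 → K | v 1 = f (v 0)}) (m c : K) :
    (univ : Set K).Definable L {v : Fin 2 → K | v 1 = f (v 0) - (m * v 0 + c)} := by
  have hlin : (univ : Set K).DefinableFun L (fun v : Fin 2 → K => m * v 0 + c) :=
    definableFun_apply₂_params hadd
      (definableFun_apply₂_params hmul (definableFun_const_params _ (mem_univ m))
        (definableFun_proj_params 0)) (definableFun_const_params _ (mem_univ c))
  have hG : (univ : Set K).DefinableFun L (fun v : Fin 2 → K => v 1 + (m * v 0 + c)) :=
    definableFun_apply₂_params hadd (definableFun_proj_params 1) hlin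
  have hF : (univ : Set K).DefinableFun L (fun v : Fin 2 → K => f (v 0)) :=
    definableFun_apply_params hf (definableFun_proj_params 0)
  have h := definable_setOf_eq_params hF hG
  refine (congrArg _ ?_).mpr h
  ext v
  simp only [mem_setOf_eq]
  constructor
  · intro hv; rw [hv]; ring
  · intro hv; rw [hv]; ring

/-- **The mean value theorem for definable functions** in a definably complete ordered field
(Rolle's theorem applied to `y ↦ f y - m y`, `m` the slope of the chord): with the graphs of
`<`, `+`, `*` and `f` definable, `f` continuous on `[a, b]` (`a < b`) and differentiable on
`(a, b)`, some `c ∈ (a, b)` has `f' c = (f b - f a) / (b - a)`. [folklore] -/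
theorem _root_.FirstOrder.Language.IsDefinablyComplete.exists_hasFieldDerivAt_eq_slope
    (hDC : L.IsDefinablyComplete K)
    (hlt : (univ : Set K).Definable L {v : Fin 2 → K | v 0 < v 1})
    (hadd : (univ : Set K).Definable L {v : Fin 3 → K | v 2 = v 0 + v 1})
    (hmul : (univ : Set K).Definable L {v : Fin 3 → K | v 2 = v 0 * v 1})
    (hf : (univ : Set K).Definable L {v : Fin 2 → K | v 1 = f (v 0)})
    {f' : K → K} {a b : K} (hab : a < b) (hcont : ContinuousOn f (Icc a b))
    (hder : ∀ x ∈ Ioo a b, HasFieldDerivAt f (f' x) x) :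
    ∃ c ∈ Ioo a b, f' c = (f b - f a) / (b - a) := by
  set m := (f b - f a) / (b - a) with hm
  have hba : b - a ≠ 0 := sub_ne_zero.2 hab.ne'
  have hcont' : ContinuousOn (fun y => f y - (m * y + 0)) (Icc a b) :=
    hcont.sub ((continuous_const.mul continuous_id).add continuous_const).continuousOn
  obtain ⟨c, hc, hc0⟩ := hDC.exists_hasFieldDerivAt_eq_zero hlt hadd
    (f := fun y => f y - (m * y + 0)) (definable_graph_sub_linear hadd hmul hf m 0)
    (f' := fun x => f' x - m) hab hcont' (fun x hx => (hder x hx).sub_linear m 0)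
    (by simp only [hm, add_zero]; field_simp; ring)
  exact ⟨c, hc, sub_eq_zero.1 hc0⟩

/-- **Zero derivative on `(a, b)` forces `f b = f a`** (for `f` continuous on `[a, b]` with
definable graph). [folklore] -/
theorem _root_.FirstOrder.Language.IsDefinablyComplete.eq_of_hasFieldDerivAt_eq_zero
    (hDC : L.IsDefinablyComplete K)
    (hlt : (univ : Set K).Definable L {v : Fin 2 → K | v 0 < v 1})
    (hadd : (univ : Set K).Definable L {v : Fin 3 → K | v 2 = v 0 + v 1})
    (hmul : (univ : Set K).Definable L {v : Fin 3 → K | v 2 = v 0 * v 1})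
    (hf : (univ : Set K).Definable L {v : Fin 2 → K | v 1 = f (v 0)})
    {a b : K} (hab : a < b) (hcont : ContinuousOn f (Icc a b))
    (hder : ∀ x ∈ Ioo a b, HasFieldDerivAt f 0 x) : f b = f a := by
  obtain ⟨c, -, hc⟩ := hDC.exists_hasFieldDerivAt_eq_slope hlt hadd hmul hf (f' := fun _ => 0) hab
    hcont hder
  have hba : b - a ≠ 0 := sub_ne_zero.2 hab.ne'
  have : f b - f a = 0 := by
    rcases div_eq_zero_iff.1 hc.symm with h | h
    · exact h
    · exact absurd h hba
  exact sub_eq_zero.1 this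

/-- **Positive derivative on `(a, b)` forces `f a < f b`.** [folklore] -/
theorem _root_.FirstOrder.Language.IsDefinablyComplete.lt_of_hasFieldDerivAt_pos
    (hDC : L.IsDefinablyComplete K)
    (hlt : (univ : Set K).Definable L {v : Fin 2 → K | v 0 < v 1})
    (hadd : (univ : Set K).Definable L {v : Fin 3 → K | v 2 = v 0 + v 1})
    (hmul : (univ : Set K).Definable L {v : Fin 3 → K | v 2 = v 0 * v 1})
    (hf : (univ : Set K).Definable L {v : Fin 2 → K | v 1 = f (v 0)})
    {f' : K → K} {a b : K} (hab : a < b) (hcont : ContinuousOn f (Icc a b))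
    (hder : ∀ x ∈ Ioo a b, HasFieldDerivAt f (f' x) x) (hpos : ∀ x ∈ Ioo a b, 0 < f' x) :
    f a < f b := by
  obtain ⟨c, hc, hfc⟩ := hDC.exists_hasFieldDerivAt_eq_slope hlt hadd hmul hf hab hcont hder
  have h : 0 < (f b - f a) / (b - a) := hfc ▸ hpos c hc
  have hba : 0 < b - a := sub_pos.2 hab
  exact sub_pos.1 ((div_pos_iff_of_pos_right hba).1 h)

/-- **Positive derivative makes a definable function strictly increasing** on `[a, b]`.
[folklore] -/
theorem _root_.FirstOrder.Language.IsDefinablyComplete.strictMonoOn_of_hasFieldDerivAt_pos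
    (hDC : L.IsDefinablyComplete K)
    (hlt : (univ : Set K).Definable L {v : Fin 2 → K | v 0 < v 1})
    (hadd : (univ : Set K).Definable L {v : Fin 3 → K | v 2 = v 0 + v 1})
    (hmul : (univ : Set K).Definable L {v : Fin 3 → K | v 2 = v 0 * v 1})
    (hf : (univ : Set K).Definable L {v : Fin 2 → K | v 1 = f (v 0)})
    {f' : K → K} {a b : K} (hcont : ContinuousOn f (Icc a b))
    (hder : ∀ x ∈ Ioo a b, HasFieldDerivAt f (f' x) x) (hpos : ∀ x ∈ Ioo a b, 0 < f' x) :
    StrictMonoOn f (Icc a b) := by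
  intro x hx y hy hxy
  have hsub : Icc x y ⊆ Icc a b := Icc_subset_Icc hx.1 hy.2
  have hsub' : Ioo x y ⊆ Ioo a b := Ioo_subset_Ioo hx.1 hy.2
  exact hDC.lt_of_hasFieldDerivAt_pos hlt hadd hmul hf hxy (hcont.mono hsub)
    (fun z hz => hder z (hsub' hz)) (fun z hz => hpos z (hsub' hz))

end Ordered

end Literature.ModelTheory.ExponentialFields
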